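import Summits.QuantumFields.YangMills.Theorems.BalabanUVNodesN12DirectSurjHsurjUniformB
import Summits.QuantumFields.YangMills.Theorems.BalabanUVNodesN12DirectSurjSiteBlockCurvedLocal
import HarnessLib

/-!
# BalabanUVNodes ∕ N12 — (P4)′ in closed form, PART 1: LEVEL-WISE SOLVABILITY with column supports at a (2.12) minimiser read through guarded proxies — the `hsolv` step of this
# lineage's p685568 ∕ p690553 assembly as a standalone theorem over DISPLAYED letters (curved-site-block letter `C₂ ρ₂` with the LOCAL seminorm letter `C_p`, flat blocks `Φ C_Φ`)

Cell `pub-ymgap` (HUMAN RULINGS D-0062 ∕ D-0149), WIDTH SEAT `pub-ymgap-dag-n12-w6` g9 (node N12 = [B15]; key K1⁹ `stmt-QuantumFields-27364`, `--kind proof --supports … --as helper`;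
count-neutral).  THEOREMS ONLY (0 `def`, 0 `instance`, 0 `sorry`).  Lane word dag-n12-c g23 (2026-08-29): CLAIM-3 «closed-form display edition» GO, producer-side siblings; split from
`…HsurjClosedForm` for the 400-line rule.

WHAT.  For one instance (`M₁`, `Z`, `W`, `U₀` in the fibre, chart differentiable at `0`, guarded site proxies), a flatness `δ` of the box gauges on the sharp towers at every inner site with
`δ < ρ₂` and `C₂·δ·(C_p·C_Φ) ≤ ½`, a host map (`host c ∈ {c₋, c₊}`, inner if an end-point is inner), ranks = levels and columns = the host's internal-face block bonds (level 0: the bond itself):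
every target `v` charged on ONE level `r` is attained on that level by some `x` invisible to the lower levels, with `‖x‖ ≤ (1+2C_Φ)‖v‖` and `x` supported in the columns of the charged rows —
the level-`0` rows by the identity placement, a positive level by the SUM of its curved site blocks (pairwise disjoint supports, exact on the level, footprint below).  Proof = p685568's
`hsolv` block verbatim, the curved block fed the LOCAL `C_p` letter on the range of the flat block (`…SiteBlockCurvedLocal.exists_curved_siteBlock_local`).

HONEST FRAMING.  Bookkeeping by name; the letters are HYPOTHESES (binder constants, census U4); nothing of Bałaban's asserted or refuted; N12 NOT discharged; K1⁹ NOT closed; count-neutral;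
R4 closes only the conditional finite-`𝕋⁴` rung `BalabanLadder.UV`; no summit statement is proved here and NOT the Yang–Mills mass gap (Clay).
-/

noncomputable section

open scoped BigOperators Matrix.Norms.L2Operator Topology NNReal
open Filter

namespace Summit.QuantumFields.YangMills.BalabanUVNodes.N12DirectSurjHsurjClosedFormLevels

open Literature.MathematicalPhysics.QuantumFieldTheory.Balaban1983to89
open Node00 B15DeterminingSets
open T4Continuum (T4Family)
open BlockAveragingEMLLinearised (linAvg)
open T4AdjointCovarianceUnitary (lieSU)
open B14.Eq213DetSet (Bj maxDomT Bj_of_gt)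
open B14.Eq213MaximalDomains (side)
open B14.Eq216Concrete (feeds)
open B5Eq118OneStroke (iterBlockOf)
open B15Eq112TorusCover (lift)
open T4AxialGaugeSmallField (boxPlaqs)
open Summit.QuantumFields.YangMills.BalabanUVNodes.N12DirectSurjTriangularSupport (exists_rightInverse_bound_support_of_rankwise)
open Summit.QuantumFields.YangMills.BalabanUVNodes.N12DirectSurjHsurjSupportPrelim
open Summit.QuantumFields.YangMills.BalabanUVNodes.N12DirectSurjBoxGauge (exists_boxGauge)
open Summit.QuantumFields.YangMills.BalabanUVNodes.N12DirectSurjHsurjPrelim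
open Summit.QuantumFields.YangMills.BalabanUVNodes.N12DirectSurjHsurjProxiesPrelim
open Summit.QuantumFields.YangMills.BalabanUVNodes.N12DirectSurjSiteBlockCurvedLocal (seminorm_le_of_twoSites)

section Record

variable {F : T4Family} {N : ℕ} [NeZero N] {K k : ℕ}

set_option maxHeartbeats 400000 in
/-- ★★ **LEVEL-WISE SOLVABILITY WITH COLUMN SUPPORTS** (the `hsolv` input of `…TriangularSupport.exists_rightInverse_bound_support_of_rankwise` at a minimiser read through guarded
proxies; letters displayed; see the module docstring). [cite: Balaban1985Variational, (83) p.290, (44)-(47) p.285, (153) p.301; Balaban1988Convergent, (2.2) p.255, (2.10)-(2.13) pp.256-257] -/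
theorem exists_levelSolution (hk : k ≤ (F.P K).m + (F.P K).K)
    (Q : (i : ℕ) → (PBond (F.P K) 0 → Matrix (Fin N) (Fin N) ℂ) → PBond (F.P K) i → Matrix (Fin N) (Fin N) ℂ)
    (p : Seminorm ℝ (PBond (F.P K) 0 → lieSU (Fin N))) {Cp : ℝ} (hCp : 0 ≤ Cp)
    (hpT : ∀ (Y : PBond (F.P K) 0 → lieSU (Fin N)) (S : Finset (PBond (F.P K) 0)), (∀ b, b ∉ S → Y b = 0) →
      S.card ≤ 2 * (F.P K).d * ((F.P K).L ^ (F.P K).d) ^ k → p Y ≤ Cp * ‖Y‖)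
    -- the curved-site-block letter, constants `C₂ ρ₂` (`…SiteBlockCurvedLocal.exists_curved_siteBlock_local`)
    {C₂ ρ₂ : ℝ}
    (hblk :
        ∀ (𝔹 : DetSet (F.P K)) (_ : ∀ j, k < j → 𝔹 j = ∅) (_ : k ≤ (F.P K).m + (F.P K).K) (W : MSField (F.P K) (SU N)) (U₀ : GaugeField (F.P K) 0 (SU N))
          (_ : AgreeOn 𝔹 (avgFamily (avOfRecord F N K) U₀) W) (_ : SmallBelow (avOfRecord F N K) k U₀)
          {n : ℕ} (hn : n + 1 ≤ k) (y' : Site (F.P K) (n + 1))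
          (Φ : (PBond (F.P K) (n + 1) → lieSU (Fin N)) →ₗ[ℝ] (PBond (F.P K) 0 → lieSU (Fin N))) {CΦ : ℝ} (_ : 0 ≤ CΦ)
          (_ : ∀ (v : PBond (F.P K) (n + 1) → lieSU (Fin N)) (c : PBond (F.P K) (n + 1)), (c.src = y' ∨ c.tgt = y') →
            Q (n + 1) (fun b => (Φ v b : Matrix (Fin N) (Fin N) ℂ)) c = (v c : Matrix (Fin N) (Fin N) ℂ))
          (_ : ∀ v, ‖Φ v‖ ≤ CΦ * ‖v‖)
          {Cp : ℝ} (_ : 0 ≤ Cp) (_ : ∀ v, p (Φ v) ≤ Cp * ‖Φ v‖)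
          (u : GaugeTransf (F.P K) 0 (SU N)) ⦃δ : ℝ⦄ (_ : 0 ≤ δ) (_ : δ < ρ₂) (_ : C₂ * δ * (Cp * CΦ) ≤ 1 / 2)
          (_ : ∀ c : PBond (F.P K) (n + 1), (c.src = y' ∨ c.tgt = y') → ∀ b₀ : PBond (F.P K) 0,
            (iterBlockOf (n + 1) b₀.src = c.src ∨ iterBlockOf (n + 1) b₀.src = c.tgt) →
            (iterBlockOf (n + 1) b₀.tgt = c.src ∨ iterBlockOf (n + 1) b₀.tgt = c.tgt) →
            ‖((GaugeField.gaugeAct u U₀ b₀ : SU N) : Matrix (Fin N) (Fin N) ℂ) - 1‖ ≤ δ),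
        ∀ t : PBond (F.P K) (n + 1) → lieSU (Fin N),
          ∃ X : PBond (F.P K) 0 → lieSU (Fin N),
            (∀ (c : PBond (F.P K) (n + 1)) (hc : c ∈ bondsOf (𝔹 (n + 1))), (c.src = y' ∨ c.tgt = y') →
              fderiv ℝ (msChart F N K k 𝔹 W U₀) 0 X (constrEnum 𝔹 k ⟨⟨n + 1, Nat.lt_succ_of_le hn⟩, c, hc⟩) = t c) ∧
            (∀ b : PBond (F.P K) 0, X b ≠ 0 → ∃ v, Φ v b ≠ 0) ∧
            ‖X‖ ≤ 2 * CΦ * ‖t‖)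
    -- the flat site blocks and their letter `C_Φ` (`…HsurjSupportPrelim.exists_flatBlocks_uniform`)
    (Φf : (n : ℕ) → Site (F.P K) (n + 1) → ((PBond (F.P K) (n + 1) → lieSU (Fin N)) →ₗ[ℝ] (PBond (F.P K) 0 → lieSU (Fin N)))) {CΦ : ℝ} (hCΦ1 : 1 ≤ CΦ)
    (hCΦfn : ∀ (n : ℕ), n < k → ∀ (y : Site (F.P K) (n + 1)) v, ‖Φf n y v‖ ≤ CΦ * ‖v‖)
    (hΦprops : ∀ (n : ℕ) (y : Site (F.P K) (n + 1)), n + 1 ≤ (F.P K).m + (F.P K).K →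
        (∀ (v : PBond (F.P K) (n + 1) → lieSU (Fin N)) (c : PBond (F.P K) (n + 1)), (c.src = y ∨ c.tgt = y) →
            Q (n + 1) (fun b => (Φf n y v b : Matrix (Fin N) (Fin N) ℂ)) c = (v c : Matrix (Fin N) (Fin N) ℂ)) ∧
        (∀ v (b : PBond (F.P K) 0), Φf n y v b ≠ 0 → iterBlockOf (n + 1) b.src = y ∧ iterBlockOf (n + 1) b.tgt = y ∧ iterBlockOf n b.src ≠ iterBlockOf n b.tgt))
    {M₁ : ℕ} (hM1 : 1 ≤ M₁) {Z : Set (Site (F.P K) 0)} (hdiv : side (F.P K).L M₁ k ∣ (F.P K).sitesPerDir 0)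
    {W : MSField (F.P K) (SU N)} {U₀ : GaugeField (F.P K) 0 (SU N)} (hU : AgreeOn (Bj M₁ Z k) (avgFamily (avOfRecord F N K) U₀) W)
    (hΨ : DifferentiableAt ℝ (msChart F N K k (Bj M₁ Z k) W U₀) 0)
    (hproxSite : ∀ (j : ℕ), 1 ≤ j → j ≤ k → ∀ y : Site (F.P K) j, embIter j y ∈ maxDomT M₁ Z j → ∃ U' : GaugeField (F.P K) 0 (SU N),
      (∀ c : PBond (F.P K) j, (c.src = y ∨ c.tgt = y) → ∀ b₀ : PBond (F.P K) 0,
        (iterBlockOf j b₀.src = c.src ∨ iterBlockOf j b₀.src = c.tgt) → (iterBlockOf j b₀.tgt = c.src ∨ iterBlockOf j b₀.tgt = c.tgt) → U' b₀ = U₀ b₀) ∧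
      SmallBelow (avOfRecord F N K) k U')
    {δ : ℝ} (hδ0 : 0 ≤ δ) (hδρ₂ : δ < ρ₂) (hδC : C₂ * δ * (Cp * CΦ) ≤ 1 / 2)
    (hgauge : ∀ (j : ℕ), 1 ≤ j → j ≤ k → ∀ y : Site (F.P K) j, embIter j y ∈ maxDomT M₁ Z j →
      ∃ u : GaugeTransf (F.P K) 0 (SU N), ∀ (c : PBond (F.P K) j), (c.src = y ∨ c.tgt = y) → ∀ b₀ : PBond (F.P K) 0,
        (iterBlockOf j b₀.src = c.src ∨ iterBlockOf j b₀.src = c.tgt) → (iterBlockOf j b₀.tgt = c.src ∨ iterBlockOf j b₀.tgt = c.tgt) →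
        ‖((GaugeField.gaugeAct u U₀ b₀ : SU N) : Matrix (Fin N) (Fin N) ℂ) - 1‖ ≤ δ)
    (host : (j : ℕ) → PBond (F.P K) j → Site (F.P K) j) (host_touch : ∀ j (c : PBond (F.P K) j), c.src = host j c ∨ c.tgt = host j c)
    (host_inner : ∀ j (c : PBond (F.P K) j), (embIter j c.src ∈ maxDomT M₁ Z j ∨ embIter j c.tgt ∈ maxDomT M₁ Z j) → embIter j (host j c) ∈ maxDomT M₁ Z j)
    (rank : Fin (constrCard (Bj M₁ Z k) k) → ℕ)
    (hrank : ∀ (j' : ℕ) (hj' : j' < k + 1) (c' : PBond (F.P K) j') (hc' : c' ∈ bondsOf (Bj M₁ Z k j')), rank (constrEnum (Bj M₁ Z k) k ⟨⟨j', hj'⟩, c', hc'⟩) = j')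
    (col : Fin (constrCard (Bj M₁ Z k) k) → Set (PBond (F.P K) 0))
    (hcol : ∀ (j' : ℕ) (hj' : j' < k + 1) (c' : PBond (F.P K) j') (hc' : c' ∈ bondsOf (Bj M₁ Z k j')),
      col (constrEnum (Bj M₁ Z k) k ⟨⟨j', hj'⟩, c', hc'⟩) = if j' = 0 then {b₀ | (⟨j', c'⟩ : (j : ℕ) × PBond (F.P K) j) = ⟨0, b₀⟩} else
        {b₀ | iterBlockOf j' b₀.src = host j' c' ∧ iterBlockOf j' b₀.tgt = host j' c' ∧ iterBlockOf (j' - 1) b₀.src ≠ iterBlockOf (j' - 1) b₀.tgt}) :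
    ∀ (r : ℕ) (v : Fin (constrCard (Bj M₁ Z k) k) → lieSU (Fin N)), (∀ i, rank i ≠ r → v i = 0) →
      ∃ x : PBond (F.P K) 0 → lieSU (Fin N), (∀ i, rank i = r → fderiv ℝ (msChart F N K k (Bj M₁ Z k) W U₀) 0 x i = v i) ∧
        (∀ i, rank i < r → fderiv ℝ (msChart F N K k (Bj M₁ Z k) W U₀) 0 x i = 0) ∧ ‖x‖ ≤ (1 + 2 * CΦ) * ‖v‖ ∧
        (∀ b, x b ≠ 0 → ∃ i, rank i = r ∧ v i ≠ 0 ∧ b ∈ col i) := by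
  classical
  have h𝔹 : ∀ j, k < j → Bj M₁ Z k j = ∅ := fun j hj => Bj_of_gt hj
  let inner : (j : ℕ) → Site (F.P K) j → Prop := fun j y => embIter j y ∈ maxDomT M₁ Z j
  have hCΦ0 : 0 ≤ CΦ := zero_le_one.trans hCΦ1
  set β : ℝ := 1 + 2 * CΦ with hβ_def
  have hβ0 : 0 ≤ β := by rw [hβ_def]; linarith
  have hβ1 : 1 ≤ β := by rw [hβ_def]; linarith
  have hpS : ∀ (j : ℕ) (_ : j ≤ k) (S : Finset (Site (F.P K) j)) (_ : S.card ≤ 2) (Y : PBond (F.P K) 0 → lieSU (Fin N)),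
      (∀ b, Y b ≠ 0 → iterBlockOf j b.src ∈ S) → p Y ≤ Cp * ‖Y‖ := fun j hj S hS Y hY => seminorm_le_of_twoSites hk hpT j hj S hS Y hY
  set L : (PBond (F.P K) 0 → lieSU (Fin N)) →ₗ[ℝ] (Fin (constrCard (Bj M₁ Z k) k) → lieSU (Fin N)) :=
    (fderiv ℝ (msChart F N K k (Bj M₁ Z k) W U₀) 0).toLinearMap with hL_def
  have hLapp : ∀ x i, L x i = fderiv ℝ (msChart F N K k (Bj M₁ Z k) W U₀) 0 x i := fun _ _ => rfl
  have hinj : ∀ (j : ℕ), j ≤ (F.P K).m + (F.P K).K → ∀ q q' : Site (F.P K) j, embIter j q = embIter j q' → q = q' := fun j hj q q' h => by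
    rw [← iterBlockOf_embIter j hj q, h, iterBlockOf_embIter j hj q']
  intro r v _hv
  show ∃ x : PBond (F.P K) 0 → lieSU (Fin N), (∀ i, rank i = r → L x i = v i) ∧ (∀ i, rank i < r → L x i = 0) ∧ ‖x‖ ≤ β * ‖v‖ ∧
      (∀ b, x b ≠ 0 → ∃ i, rank i = r ∧ v i ≠ 0 ∧ b ∈ col i)
  rcases Nat.eq_zero_or_pos r with rfl | hrpos
  · -- rank 0: the level-0 rows, hit by the identity placement
    obtain ⟨x, hx_def, hx_off, hxn⟩ := exists_placement (bondsOf (Bj M₁ Z k 0)) (fun b hb => constrEnum (Bj M₁ Z k) k ⟨⟨0, Nat.succ_pos k⟩, b, hb⟩) v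
    refine ⟨x, fun i hi => ?_, fun i hi => absurd hi (Nat.not_lt_zero _), hxn.trans (le_mul_of_one_le_left (norm_nonneg _) hβ1), fun b hb => ?_⟩
    · obtain ⟨⟨⟨j', hj'⟩, c', hc'⟩, rfl⟩ := (constrEnum (Bj M₁ Z k) k).surjective i
      rw [hrank] at hi
      subst hi
      rw [hLapp, fderiv_msChart_apply_levelZero hU hΨ c' hc' x, hx_def c' hc']
    · have hbm : b ∈ bondsOf (Bj M₁ Z k 0) := by
        by_contra hbm
        exact hb (hx_off b hbm)
      refine ⟨constrEnum (Bj M₁ Z k) k ⟨⟨0, Nat.succ_pos k⟩, b, hbm⟩, hrank 0 _ b hbm, by rwa [hx_def b hbm] at hb, ?_⟩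
      rw [hcol, if_pos rfl, Set.mem_setOf_eq]
  · by_cases hrk : r ≤ k
    · -- rank `n + 1 ≤ k`: the SUM of the curved site blocks at the inner `(n+1)`-sites
      obtain ⟨n, rfl⟩ : ∃ n, r = n + 1 := ⟨r - 1, by omega⟩
      have hn : n + 1 ≤ k := hrk
      have hnK : n + 1 ≤ (F.P K).m + (F.P K).K := hn.trans hk
      -- per-site solutions: the curved block at an inner site on the truncated target hosted there, zero elsewhere
      have hsite : ∀ y : Site (F.P K) (n + 1), ∃ X : PBond (F.P K) 0 → lieSU (Fin N),
          ‖X‖ ≤ 2 * CΦ * ‖v‖ ∧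
          (∀ b : PBond (F.P K) 0, X b ≠ 0 → iterBlockOf (n + 1) b.src = y ∧ iterBlockOf (n + 1) b.tgt = y ∧ iterBlockOf n b.src ≠ iterBlockOf n b.tgt ∧
            ∃ (c : PBond (F.P K) (n + 1)) (hc : c ∈ bondsOf (Bj M₁ Z k (n + 1))), host (n + 1) c = y ∧
              v (constrEnum (Bj M₁ Z k) k ⟨⟨n + 1, Nat.lt_succ_of_le hn⟩, c, hc⟩) ≠ 0) ∧
          (inner (n + 1) y → ∀ (c : PBond (F.P K) (n + 1)) (hc : c ∈ bondsOf (Bj M₁ Z k (n + 1))), (c.src = y ∨ c.tgt = y) →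
            L X (constrEnum (Bj M₁ Z k) k ⟨⟨n + 1, Nat.lt_succ_of_le hn⟩, c, hc⟩) =
              if host (n + 1) c = y then v (constrEnum (Bj M₁ Z k) k ⟨⟨n + 1, Nat.lt_succ_of_le hn⟩, c, hc⟩) else 0) ∧
          (¬ inner (n + 1) y → X = 0) := by
        intro y
        by_cases hy : inner (n + 1) y
        · obtain ⟨hΦQ, hΦsupp⟩ := hΦprops n y hnK
          obtain ⟨u, hu⟩ := hgauge (n + 1) (Nat.succ_pos n) hn y hy
          -- the guarded proxy at the site, in its own fibre; the box gauge is as flat on it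
          obtain ⟨U', hag, hsb'⟩ := hproxSite (n + 1) (Nat.succ_pos n) hn y hy
          have hu' : ∀ c : PBond (F.P K) (n + 1), (c.src = y ∨ c.tgt = y) → ∀ b₀ : PBond (F.P K) 0,
              (iterBlockOf (n + 1) b₀.src = c.src ∨ iterBlockOf (n + 1) b₀.src = c.tgt) →
              (iterBlockOf (n + 1) b₀.tgt = c.src ∨ iterBlockOf (n + 1) b₀.tgt = c.tgt) →
              ‖((GaugeField.gaugeAct u U' b₀ : SU N) : Matrix (Fin N) (Fin N) ℂ) - 1‖ ≤ δ := fun c hc b₀ hs ht => by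
            have e : GaugeField.gaugeAct u U' b₀ = GaugeField.gaugeAct u U₀ b₀ := by
              show u b₀.src * U' b₀ * (u b₀.tgt)⁻¹ = u b₀.src * U₀ b₀ * (u b₀.tgt)⁻¹
              rw [hag c hc b₀ hs ht]
            rw [e]; exact hu c hc b₀ hs ht
          -- the truncated target hosted at `y`
          obtain ⟨t, ht_def, htn, ht_ne⟩ := exists_truncTarget (bondsOf (Bj M₁ Z k (n + 1)))
            (fun c hc => constrEnum (Bj M₁ Z k) k ⟨⟨n + 1, Nat.lt_succ_of_le hn⟩, c, hc⟩) (host (n + 1)) y v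
          have hpΦ : ∀ v, p (Φf n y v) ≤ Cp * ‖Φf n y v‖ := fun v =>
            hpS (n + 1) hn {y} (by rw [Finset.card_singleton]; omega) (Φf n y v) fun b hb => by
              rw [Finset.mem_singleton]; exact (hΦsupp v b hb).1
          obtain ⟨X, hXrows, hXsupp, hXn⟩ := hblk (Bj M₁ Z k) h𝔹 hk (avgFamily (avOfRecord F N K) U') U' (fun _ _ _ => rfl) hsb' hn y (Φf n y) hCΦ0 hΦQ
            (hCΦfn n (Nat.lt_of_succ_le hn) y) hCp hpΦ u hδ0 hδρ₂ hδC hu' t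
          have hXsupp' : ∀ b : PBond (F.P K) 0, X b ≠ 0 →
              iterBlockOf (n + 1) b.src = y ∧ iterBlockOf (n + 1) b.tgt = y ∧ iterBlockOf n b.src ≠ iterBlockOf n b.tgt := fun b hb => by
            obtain ⟨w, hw⟩ := hXsupp b hb
            exact hΦsupp w b hw
          have htne : (∃ b : PBond (F.P K) 0, X b ≠ 0) → t ≠ 0 := by
            rintro ⟨b, hb⟩ rfl
            rw [norm_zero, mul_zero] at hXn
            exact hb (by rw [norm_le_zero_iff.1 hXn]; rfl)
          refine ⟨X, hXn.trans ?_, fun b hb => ?_, fun _ c hc hcy => ?_, fun h => absurd hy h⟩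
          · exact mul_le_mul_of_nonneg_left htn (by positivity)
          · obtain ⟨h1, h2, h3⟩ := hXsupp' b hb
            obtain ⟨c, hc, hhost, hvc⟩ := ht_ne (htne ⟨b, hb⟩)
            exact ⟨h1, h2, h3, c, hc, hhost, hvc⟩
          · rw [hLapp, fderiv_msChart_apply_eq_of_sharpProxy hk hU hΨ hsb' (constrEnum (Bj M₁ Z k) k ⟨⟨n + 1, Nat.lt_succ_of_le hn⟩, c, hc⟩)
              (by rw [Equiv.symm_apply_apply]; exact fun b₀ hs ht => hag c hcy b₀ hs ht) X, hXrows c hc hcy, ht_def c hc]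
        · refine ⟨0, ?_, fun b hb => absurd rfl hb, fun h => absurd h hy, fun _ => rfl⟩
          rw [norm_zero]; positivity
      choose Xs hXsn hXsupp hXrows hXzero using hsite
      set x : PBond (F.P K) 0 → lieSU (Fin N) := ∑ y : Site (F.P K) (n + 1), Xs y with hx_def
      have hx_apply : ∀ b : PBond (F.P K) 0, x b = Xs (iterBlockOf (n + 1) b.src) b := fun b => by
        rw [hx_def]; exact sum_apply_eq_of_support (fun b : PBond (F.P K) 0 => iterBlockOf (n + 1) b.src) Xs (fun y b hb => (hXsupp y b hb).1) b
      -- the footprint of one site solution on the rows of level `≤ n` and on the level-`(n+1)` rows not touching its site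
      have hfoot : ∀ (y : Site (F.P K) (n + 1)) (j' : ℕ) (hj' : j' < k + 1) (c' : PBond (F.P K) j') (hc' : c' ∈ bondsOf (Bj M₁ Z k j')),
          (j' ≤ n ∨ (j' = n + 1 ∧ embIter j' c'.src ≠ embIter (n + 1) y ∧ embIter j' c'.tgt ≠ embIter (n + 1) y)) →
          L (Xs y) (constrEnum (Bj M₁ Z k) k ⟨⟨j', hj'⟩, c', hc'⟩) = 0 := by
        intro y j' hj' c' hc' hjc
        by_cases hy : inner (n + 1) y
        · have hfp := fderiv_msChart_apply_eq_zero_of_siteSupport' (F := F) hM1 hdiv hk hΨ hn hy (Xs y)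
            (fun b hb => ⟨(hXsupp y b hb).1, (hXsupp y b hb).2.1, (hXsupp y b hb).2.2.1⟩) (constrEnum (Bj M₁ Z k) k ⟨⟨j', hj'⟩, c', hc'⟩)
          rw [Equiv.symm_apply_apply] at hfp
          rw [hLapp]
          exact hfp hjc
        · rw [hXzero y hy, map_zero]; rfl
      refine ⟨x, fun i hi => ?_, fun i hi => ?_, ?_, fun b hb => ?_⟩
      · -- rows of rank `n + 1`: exactly the host's block contributes
        obtain ⟨⟨⟨j', hj'⟩, c', hc'⟩, rfl⟩ := (constrEnum (Bj M₁ Z k) k).surjective i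
        rw [hrank] at hi
        subst hi
        have hin : inner (n + 1) (host (n + 1) c') := host_inner _ c' (inner_endpoint_of_mem_bondsOf_Bj (Nat.succ_pos n) hn hc')
        rw [hx_def, map_sum, Finset.sum_apply, Finset.sum_eq_single (host (n + 1) c')]
        · rw [hXrows (host (n + 1) c') hin c' hc' (host_touch _ c'), if_pos rfl]
        · intro y _ hne
          by_cases hy : inner (n + 1) y
          · by_cases hcy : c'.src = y ∨ c'.tgt = y
            · rw [hXrows y hy c' hc' hcy, if_neg (Ne.symm hne)]
            · exact hfoot y (n + 1) hj' c' hc' (Or.inr ⟨rfl, fun hs => hcy (Or.inl (hinj (n + 1) hnK _ _ hs)), fun ht => hcy (Or.inr (hinj (n + 1) hnK _ _ ht))⟩)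
          · rw [hXzero y hy, map_zero]; rfl
        · intro h; exact absurd (Finset.mem_univ _) h
      · -- rows of smaller rank: level `≤ n`, every site solution is invisible
        obtain ⟨⟨⟨j', hj'⟩, c', hc'⟩, rfl⟩ := (constrEnum (Bj M₁ Z k) k).surjective i
        rw [hrank] at hi
        rw [hx_def, map_sum, Finset.sum_apply]
        exact Finset.sum_eq_zero fun y _ => hfoot y j' hj' c' hc' (Or.inl (Nat.lt_succ_iff.1 hi))
      · -- the letter: disjoint supports, so the sup norm of the sum is a sup of the blocks' norms
        refine (pi_norm_le_iff_of_nonneg (mul_nonneg hβ0 (norm_nonneg v))).2 fun b => ?_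
        rw [hx_apply b]
        refine (norm_le_pi_norm _ b).trans ((hXsn _).trans ?_)
        rw [hβ_def]
        nlinarith [norm_nonneg v, hCΦ0]
      · -- the column support
        rw [hx_apply b] at hb
        obtain ⟨h1, h2, h3, c, hc, hhost, hvc⟩ := hXsupp _ b hb
        refine ⟨constrEnum (Bj M₁ Z k) k ⟨⟨n + 1, Nat.lt_succ_of_le hn⟩, c, hc⟩, hrank _ _ c hc, hvc, ?_⟩
        rw [hcol, if_neg (Nat.succ_ne_zero n), Set.mem_setOf_eq, hhost, Nat.add_sub_cancel]
        exact ⟨h1, h2, h3⟩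
    · -- no row has rank `r > k`: `x = 0`
      refine ⟨0, fun i hi => ?_, fun i _ => by rw [map_zero]; rfl, by rw [norm_zero]; exact mul_nonneg hβ0 (norm_nonneg _),
        fun b hb => absurd rfl hb⟩
      exfalso
      obtain ⟨⟨⟨j', hj'⟩, c', hc'⟩, rfl⟩ := (constrEnum (Bj M₁ Z k) k).surjective i
      rw [hrank] at hi
      omega
end Record

end Summit.QuantumFields.YangMills.BalabanUVNodes.N12DirectSurjHsurjClosedFormLevels

end
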